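import Literature.Probability.RandomPlanarGeometry.HexSAWPolygonCellsHostTransfer
import HarnessLib

/-!
# Cell calculus for honeycomb polygon surgery, X: the peeled part hangs on HOSTS of the base (LEMMA D, stick structure)

Topic `Literature/Probability/RandomPlanarGeometry` (lane «pcv-sawmu», a-p4 g21; sequel of `HexSAWPolygonCellsPeel.lean` (`peel`) and
`HexSAWPolygonCellsHostTransfer.lean` (CLAIM H)).

LEMMA D of `HOME/pub-sawmu-a-p4/g21/omega/THEOREM-OMEGA-g21.md` §3, structural half: every peeled hexagon `c ∈ S ∖ peel S` is an up-right
spike over its lower-left neighbour — `LL c ∈ S` (`ll_mem_of_mem_sdiff_peel`) — and following `LL` one stays in the peeled part until one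
reaches a HOST of the base: `LL c ∈ S ∖ peel S` or `IsHost (peel S) (LL c)` (`ll_mem_sdiff_or_isHost`).  Hosts persist when other hexagons
are removed (`IsHost.mono`), which is what makes the induction over the peeling work.  Consequently the peeled part is a disjoint union of
up-right sticks `{UR h, UR² h, …}` standing on hosts `h` of `peel S` (the explicit stick-length function is the subject of the sequel).

Sources: N. Madras, G. Slade, *The Self-Avoiding Walk* (1993), §3.2, proof of Theorem 3.2.3 [MadrasSlade1993]; I. Jensen, J. Phys.: Conf.
Ser. 42 (2006) 163 [Jensen2006HoneycombPolygons].  Label (lane): LANE INFRASTRUCTURE; nothing new in writing.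
-/

open Finset

namespace Literature.Probability.RandomPlanarGeometry.SAW

namespace HexCell

/-- Hosts persist when other hexagons are removed. [cite: MadrasSlade1993, §3.2 (proof of Theorem 3.2.3)] -/
theorem IsHost.mono {T T' : Finset Cell} {d : Cell} (h : IsHost T d) (hsub : T' ⊆ T) (hd : d ∈ T') : IsHost T' d :=
  ⟨hd, fun hx => h.2.1 (hsub hx), fun hx => h.2.2.1 (hsub hx), fun c hc => h.2.2.2 c (hsub hc)⟩

open Classical in
/-- The peeled part decomposes along a peeling step: `S ∖ peel S = {m} ∪ (S.erase m ∖ peel (S.erase m))` for a peelable top `m`.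
[cite: MadrasSlade1993, §3.2 (proof of Theorem 3.2.3)] -/
theorem sdiff_peel_eq_insert {S : Finset Cell} {m : Cell} (hm : Peelable S m) :
    S \ peel S = insert m (S.erase m \ peel (S.erase m)) := by
  rw [peel_eq_peel_erase hm]
  have hm' : m ∉ peel (S.erase m) := fun hx => notMem_erase m S (peel_subset _ hx)
  ext c
  simp only [mem_sdiff, mem_insert, mem_erase]
  constructor
  · rintro ⟨hc, hnp⟩
    by_cases e : c = m
    · exact Or.inl e
    · exact Or.inr ⟨⟨e, hc⟩, hnp⟩
  · rintro (rfl | ⟨⟨-, hc⟩, hnp⟩)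
    · exact ⟨hm.mem, hm'⟩
    · exact ⟨hc, hnp⟩

open Classical in
/-- ★ **Every peeled hexagon is a spike over its lower-left neighbour**: `c ∈ S ∖ peel S ⇒ LL c ∈ S`.
[cite: MadrasSlade1993, §3.2 (proof of Theorem 3.2.3)] -/
theorem ll_mem_of_mem_sdiff_peel {S : Finset Cell} {c : Cell} (hc : c ∈ S \ peel S) : LL c ∈ S := by
  induction S using Finset.strongInduction generalizing c with
  | H S ih =>
    by_cases h : ∃ m, Peelable S m
    · obtain ⟨m, hm⟩ := h
      rw [sdiff_peel_eq_insert hm, mem_insert] at hc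
      rcases hc with rfl | hc
      · exact hm.1.ll_mem
      · exact (mem_erase.1 (ih _ (erase_ssubset hm.mem) hc)).2
    · rw [peel_eq_self h, sdiff_self] at hc
      exact absurd hc (Finset.notMem_empty c)

open Classical in
/-- ★ **Following `LL` from a peeled hexagon one stays in the peeled part until a HOST of the base**:
`c ∈ S ∖ peel S ⇒ LL c ∈ S ∖ peel S ∨ IsHost (peel S) (LL c)`. [cite: MadrasSlade1993, §3.2 (proof of Theorem 3.2.3)] -/
theorem ll_mem_sdiff_or_isHost {S : Finset Cell} {c : Cell} (hc : c ∈ S \ peel S) :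
    LL c ∈ S \ peel S ∨ IsHost (peel S) (LL c) := by
  induction S using Finset.strongInduction generalizing c with
  | H S ih =>
    by_cases h : ∃ m, Peelable S m
    · obtain ⟨m, hm⟩ := h
      have hstep := sdiff_peel_eq_insert hm
      rw [hstep, mem_insert] at hc
      rcases hc with rfl | hc
      · -- the freshly peeled top: its support is a host of `S.erase c`, hence of `peel (S.erase c)` if it survives the peeling
        have hh : IsHost (S.erase c) (LL c) := isHost_erase_ll_of_isSpikeTop hm.1
        by_cases hin : LL c ∈ peel (S.erase c)
        · right
          rw [peel_eq_peel_erase hm]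
          exact hh.mono (peel_subset _) hin
        · left
          rw [hstep, mem_insert]
          exact Or.inr (mem_sdiff.2 ⟨hh.1, hin⟩)
      · rcases ih _ (erase_ssubset hm.mem) hc with h1 | h2
        · left; rw [hstep, mem_insert]; exact Or.inr h1
        · right; rw [peel_eq_peel_erase hm]; exact h2
    · rw [peel_eq_self h, sdiff_self] at hc
      exact absurd hc (Finset.notMem_empty c)

/-- A peeled hexagon is never in the base. [cite: MadrasSlade1993, §3.2 (proof of Theorem 3.2.3)] -/
theorem notMem_peel_of_mem_sdiff {S : Finset Cell} {c : Cell} (hc : c ∈ S \ peel S) : c ∉ peel S := (mem_sdiff.1 hc).2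

open Classical in
/-- Every peeled hexagon lies strictly above the base in the lexicographic order: it is above `UR`… precisely, for `c ∈ S ∖ peel S` and every
`b ∈ peel S`, `b.y < c.y ∨ (b.y = c.y ∧ b.x < c.x)`. [cite: MadrasSlade1993, §3.2 (proof of Theorem 3.2.3)] -/
theorem lt_of_mem_peel_of_mem_sdiff {S : Finset Cell} {c b : Cell} (hc : c ∈ S \ peel S) (hb : b ∈ peel S) :
    b.2 < c.2 ∨ (b.2 = c.2 ∧ b.1 < c.1) := by
  induction S using Finset.strongInduction generalizing c with
  | H S ih =>
    by_cases h : ∃ m, Peelable S m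
    · obtain ⟨m, hm⟩ := h
      have hstep := sdiff_peel_eq_insert hm
      rw [hstep, mem_insert] at hc
      have hb' : b ∈ peel (S.erase m) := by rw [← peel_eq_peel_erase hm]; exact hb
      rcases hc with rfl | hc
      · -- `b ∈ peel (S.erase c) ⊆ S.erase c`, and `c` is the top hexagon of `S`
        have hbS := mem_erase.1 (peel_subset _ hb')
        rcases hm.1.1.2 b hbS.2 with h1 | ⟨h1, h2⟩
        · exact Or.inl h1
        · right; refine ⟨h1, lt_of_le_of_ne h2 ?_⟩
          intro e; apply hbS.1; ext <;> assumption
      · exact ih _ (erase_ssubset hm.mem) hc hb'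
    · rw [peel_eq_self h, sdiff_self] at hc
      exact absurd hc (Finset.notMem_empty c)

end HexCell

end Literature.Probability.RandomPlanarGeometry.SAW
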